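import Mathlib
import Summits.ResolutionOfSingularities.ResolutionOfSingularities.Theorems.WeightedInvariantLocalWeightedDropWildMonicFlagDropSplit

/-!
# `WeightedInvariant.LocalWeightedDrop`, line `hasse-ridge-face-selection`, S3ρ: the AXIS DROP split by the TYPE OF THE CHILD FLAG —
# five targets of record for the hands of (C6) (C7) (C8)

Crux item stmt-ResolutionOfSingularities-8899 `LocalWeightedDrop` (route `ResolutionOfSingularities/WeightedInvariant`), engine of the
door `HypersurfaceCentreConstruction` stmt-ResolutionOfSingularities-19897.  [OURS · L1 W4.3, chain w43, res-type-083 (S3ρ first seat,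
(C9) lead).  MAP: S. Perlega, arXiv:2011.14443 Ch. 9: Prop 9.1.1 (induced flags), Lemma 9.1.2 (flags `G` with `G₁ = G₂ ∩ D_new`),
Prop 9.1.4 proof cases (1) (3) (4) (p0103–p0106); every object is OURS; not a statement of any manuscript.]

`DropAxisShape d p k` (`…WildMonicFlagDropSplit`: along the axis successor `x^{d-j}·T_j = A_j(x, xy)` every valid admissible child flag
`(o, g, h)` of `(shift d T φ', succE 0 E)` is dominated — strictly, or weakly with `s = ⊤` — by a valid admissible FIRST-ORIENTATION flag
of the raw parent `(A, E)`) is the conjunction (`dropAxisShape_of_cases`) of FIVE statements, one per type of the child flag.  Letters of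
the child: `0 = x` (the exceptional curve `D_new`), `1 = y′` (strict transform of `V(x₂)`, a boundary letter iff `V(x₂)` was one);
`E′ = succE 0 E`.
* `DropAxisN0First`       — `o = false`, `IsN0 E′ h`: curves `V(y′ + h(x))` transversal to `D_new` (and `h = 0` if `V(y′)` is boundary)
                            [Per17 9.1.4 case (1): `n_G = 0`, `t = 0`; tools (C1)–(C4): w- and s-cleanness transport, stub-7];
* `DropAxisTangentFirst`  — `o = false`, `IsTangent E′ h`: `V(y′)` boundary and `V(y′ + h(x))` tangent to it (`ord h ≥ 2`) or `ord h = 1`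
                            (`n_G = 1`) [case (3); tools: stub-5's FlagN1/FlagNn transport, FlagLexSteps, Lemma 9.1.3 shapes];
* `DropAxisN0Second`      — `o = true`, `IsN0 (swapE E′) h`, which forces `h = 0`: the flag whose curve IS `D_new` [Lemma 9.1.2: dominated
                            by the induced flag `(g, 0)` of the first orientation];
* `DropAxisN1Second`      — `o = true`, `IsTangent (swapE E′) h`, `ord h = 1` (then `V(y′)` is boundary): the `n_G = 1` flag presented as a
                            graph over `y′` [case (3), second presentation];
* `DropAxisKangaroo`      — `o = true`, `IsTangent (swapE E′) h`, `2 ≤ ord h`: curves `V(x + h(y′))` TANGENT TO `D_new` [case (4) at `t = 0`,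
                            the KANGAROO: Per17 Props 6.2.3/6.2.4 for tuples — res-type-056's (C8)].
-/

set_option linter.dupNamespace false -- mandated namespace of this single-conjunct summit

noncomputable section

namespace Summit.ResolutionOfSingularities.ResolutionOfSingularities.Theorems

open Literature.AlgebraicGeometry.Resolution
open Literature.AlgebraicGeometry.Resolution.HauserPerlega2024 (Triple)

namespace WildMonic

open MvPowerSeries
open PurePowerFlag (swap swapE orient orientE IsN0 IsTangent succE)

variable {k : Type} [Field k] {d : ℕ}

/-! ### The common conclusion: a first-orientation parent dominator -/

/-- «`w` is dominated by a valid admissible FIRST-ORIENTATION flag of `(A, E)` — strictly, or weakly by one with `s = ⊤`»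
(the conclusion of `DropAxisShape`). -/
def FirstDominates (d : ℕ) (A : Fin d → MvPowerSeries (Fin 2) k) (E : Finset (Fin 2)) (w : Triple) : Prop :=
  ∃ (g₀ : MvPowerSeries (Fin 2) k) (h₀ : PowerSeries k), constantCoeff g₀ = 0 ∧ PowerSeries.constantCoeff h₀ = 0 ∧
    (IsN0 E h₀ ∨ IsTangent E h₀) ∧ IsMMax d A E g₀ h₀ ∧ w ≤ flagTriple d A E g₀ h₀ ∧
    (w < flagTriple d A E g₀ h₀ ∨ (ofLex (ofLex (flagTriple d A E g₀ h₀)).2).2 = ⊤)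

/-- «`(A, E; T, φ')` is a charged AXIS STEP»: raw parent position off `Exit₃`, axis successor `x^{d-j}·T_j = A_j(x, xy)`, re-centring `φ'`
to a child position off `Exit₃` (the common hypothesis block of the five statements). -/
def IsAxisStep (d p : ℕ) (A : Fin d → MvPowerSeries (Fin 2) k) (T : Fin d → MvPowerSeries (Fin 2) k) (φ' : MvPowerSeries (Fin 2) k) :
    Prop :=
  IsPos d A ∧ ¬ Exit₃ p d A ∧ (∀ j : Fin d, X 0 ^ (d - (j : ℕ)) * T j = subst (PlaneGerm.dirChart (0 : k)) (A j)) ∧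
    constantCoeff φ' = 0 ∧ IsPos d (shift d T φ') ∧ ¬ Exit₃ p d (shift d T φ')

/-! ### The five child-flag types -/

/-- TYPE N0-FIRST [Per17 9.1.4 case (1)]: child flags `(false, g, h)` with `IsN0 (succE 0 E) h`. -/
def DropAxisN0First (d p : ℕ) (k : Type) [Field k] : Prop :=
  ∀ (A : Fin d → MvPowerSeries (Fin 2) k) (E : Finset (Fin 2)) (T : Fin d → MvPowerSeries (Fin 2) k) (φ' : MvPowerSeries (Fin 2) k),
    IsAxisStep d p A T φ' →
    ∀ (g : MvPowerSeries (Fin 2) k) (h : PowerSeries k), constantCoeff g = 0 → PowerSeries.constantCoeff h = 0 →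
      IsN0 (succE (0 : k) E) h → IsMMax d (shift d T φ') (succE (0 : k) E) g h →
      FirstDominates d A E (flagTriple d (shift d T φ') (succE (0 : k) E) g h)

/-- TYPE TANGENT-FIRST [Per17 9.1.4 case (3)]: child flags `(false, g, h)` with `IsTangent (succE 0 E) h` (so `V(x₂)` was boundary and survives;
`ord h ≥ 2`: tangent to the old component; `ord h = 1`: `n_G = 1`). -/
def DropAxisTangentFirst (d p : ℕ) (k : Type) [Field k] : Prop :=
  ∀ (A : Fin d → MvPowerSeries (Fin 2) k) (E : Finset (Fin 2)) (T : Fin d → MvPowerSeries (Fin 2) k) (φ' : MvPowerSeries (Fin 2) k),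
    IsAxisStep d p A T φ' →
    ∀ (g : MvPowerSeries (Fin 2) k) (h : PowerSeries k), constantCoeff g = 0 → PowerSeries.constantCoeff h = 0 →
      IsTangent (succE (0 : k) E) h → IsMMax d (shift d T φ') (succE (0 : k) E) g h →
      FirstDominates d A E (flagTriple d (shift d T φ') (succE (0 : k) E) g h)

/-- TYPE N0-SECOND [Per17 Lemma 9.1.2]: child flags `(true, g, h)` with `IsN0 (swapE (succE 0 E)) h` — necessarily `h = 0`, the flag whose curve
is the exceptional curve `D_new` itself. -/
def DropAxisN0Second (d p : ℕ) (k : Type) [Field k] : Prop :=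
  ∀ (A : Fin d → MvPowerSeries (Fin 2) k) (E : Finset (Fin 2)) (T : Fin d → MvPowerSeries (Fin 2) k) (φ' : MvPowerSeries (Fin 2) k),
    IsAxisStep d p A T φ' →
    ∀ (g : MvPowerSeries (Fin 2) k), constantCoeff g = 0 →
      IsMMax d (swapT (shift d T φ')) (swapE (succE (0 : k) E)) g 0 →
      FirstDominates d A E (flagTriple d (swapT (shift d T φ')) (swapE (succE (0 : k) E)) g 0)

/-- TYPE N1-SECOND [Per17 9.1.4 case (3), second presentation]: child flags `(true, g, h)` with `ord h = 1` (hence `IsTangent` forces `V(y′)`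
boundary): the `n_G = 1` flag presented as a graph over `y′`. -/
def DropAxisN1Second (d p : ℕ) (k : Type) [Field k] : Prop :=
  ∀ (A : Fin d → MvPowerSeries (Fin 2) k) (E : Finset (Fin 2)) (T : Fin d → MvPowerSeries (Fin 2) k) (φ' : MvPowerSeries (Fin 2) k),
    IsAxisStep d p A T φ' →
    ∀ (g : MvPowerSeries (Fin 2) k) (h : PowerSeries k), constantCoeff g = 0 → PowerSeries.constantCoeff h = 0 →
      IsTangent (swapE (succE (0 : k) E)) h → h.order = 1 →
      IsMMax d (swapT (shift d T φ')) (swapE (succE (0 : k) E)) g h →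
      FirstDominates d A E (flagTriple d (swapT (shift d T φ')) (swapE (succE (0 : k) E)) g h)

/-- TYPE KANGAROO [Per17 9.1.4 case (4) at `t = 0`]: child flags `(true, g, h)` with `2 ≤ ord h`: curves `V(x + h(y′))` tangent to `D_new`. -/
def DropAxisKangaroo (d p : ℕ) (k : Type) [Field k] : Prop :=
  ∀ (A : Fin d → MvPowerSeries (Fin 2) k) (E : Finset (Fin 2)) (T : Fin d → MvPowerSeries (Fin 2) k) (φ' : MvPowerSeries (Fin 2) k),
    IsAxisStep d p A T φ' →
    ∀ (g : MvPowerSeries (Fin 2) k) (h : PowerSeries k), constantCoeff g = 0 → PowerSeries.constantCoeff h = 0 →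
      IsTangent (swapE (succE (0 : k) E)) h → (2 : ℕ∞) ≤ h.order →
      IsMMax d (swapT (shift d T φ')) (swapE (succE (0 : k) E)) g h →
      FirstDominates d A E (flagTriple d (swapT (shift d T φ')) (swapE (succE (0 : k) E)) g h)

/-! ### The split -/

/-- An `IsN0` flag of the SECOND orientation at the child has `h = 0` (the exceptional letter `0` is always boundary, and it is the
letter `1` of the swapped boundary). -/
theorem eq_zero_of_isN0_swapE_succE {t : k} {E : Finset (Fin 2)} {h : PowerSeries k} (hn : IsN0 (swapE (succE t E)) h) : h = 0 := by
  rcases hn with h1 | h0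
  · exfalso
    apply h1
    rw [PurePowerFlag.mem_swapE, Equiv.swap_apply_right]
    unfold succE
    split_ifs <;> simp
  · exact h0

/-- A series without constant term has `ord = 1` or `ord ≥ 2`. -/
theorem order_eq_one_or_two_le {h : PowerSeries k} (hh : PowerSeries.constantCoeff h = 0) :
    h.order = 1 ∨ (2 : ℕ∞) ≤ h.order := by
  have h1 : (1 : ℕ∞) ≤ h.order := by
    refine PowerSeries.le_order h 1 fun i hi => ?_
    have hi0 : i = 0 := by
      have hi' : (i : ℕ∞) < ((1 : ℕ) : ℕ∞) := by simpa using hi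
      have := (Nat.cast_lt.mp hi')
      omega
    subst hi0
    rwa [PowerSeries.coeff_zero_eq_constantCoeff]
  generalize hn : h.order = n at h1 ⊢
  induction n using ENat.recTopCoe with
  | top => exact Or.inr le_top
  | coe n =>
    have h1' : 1 ≤ n := by exact_mod_cast h1
    rcases Nat.eq_or_lt_of_le h1' with h | h
    · exact Or.inl (by rw [← h]; rfl)
    · exact Or.inr (by exact_mod_cast h)

/-- **`DropAxisShape` FROM THE FIVE CHILD-FLAG TYPES.** -/
theorem dropAxisShape_of_cases {p : ℕ} (h1 : DropAxisN0First d p k) (h2 : DropAxisTangentFirst d p k) (h3 : DropAxisN0Second d p k)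
    (h4 : DropAxisN1Second d p k) (h5 : DropAxisKangaroo d p k) : DropAxisShape d p k := by
  intro A E T φ' hA hex hT hφ' hpos' hex' o g h hg hh hadm hmm
  have hstep : IsAxisStep d p A T φ' := ⟨hA, hex, hT, hφ', hpos', hex'⟩
  cases o
  · -- first orientation
    rw [orientT_false, PurePowerFlag.orientE_false] at hmm ⊢
    rw [PurePowerFlag.orientE_false] at hadm
    rcases hadm with hn | ht
    · exact h1 A E T φ' hstep g h hg hh hn hmm
    · exact h2 A E T φ' hstep g h hg hh ht hmm
  · -- second orientation
    rw [orientT_true, PurePowerFlag.orientE_true] at hmm ⊢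
    rw [PurePowerFlag.orientE_true] at hadm
    rcases hadm with hn | ht
    · have h0 : h = 0 := eq_zero_of_isN0_swapE_succE hn
      subst h0
      exact h3 A E T φ' hstep g hg hmm
    · rcases order_eq_one_or_two_le hh with h1' | h2'
      · exact h4 A E T φ' hstep g h hg hh ht h1' hmm
      · exact h5 A E T φ' hstep g h hg hh ht h2' hmm

end WildMonic

end Summit.ResolutionOfSingularities.ResolutionOfSingularities.Theorems

end
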